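import Summits.QuantumFields.YangMills.Theorems.BalabanUVNodesClusters
import Summits.QuantumFields.YangMills.Theorems.BalabanUVNodesN27LedgerJoinTail
import Summits.QuantumFields.BalabanUV.T4Continuum.Support.HistoryRealiseCellsRunApex

/-!
# BalabanUVNodes ∕ N27 = binder B5 AT THE RECORD, XIII — NORMALISATION: the route module's `SpineDatum` IS the apex's per-string shape
# `StringHybridNE7` (faithfulness below the prefix), and it is reached from class weights in ANY positive per-cutoff normalisation — in
# particular from the E1∕E2 REPRESENTATION IDENTITIES IN BAŁABAN'S NORMALISATION `∫ e^{t·obs_K} ρ₀ dU = Σ_{τ ∈ T K} A K t τ` (the count road's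
# `reprA` ∕ `reprB` letter), the Wilson rescaling `exists_const_schemeZ` being absorbed by the join
# (cell `pub-ymgap`, HUMAN RULING D-0062 Track A, seat `pub-ymgap-dag-n27-a` g4; `--supports stmt-QuantumFields-19182`, count-neutral)

WHY.  The K5 stub `S_N27x` (the term-class expansion of record EXISTS, with the E1∕E2 dictionary) states E1∕E2 against the apex's WILSON-normalised
dressed partition functions `T4GenFunBounds.schemeZ (D.scheme g₀) os K t`.  Bałaban's densities are normalised differently: `ρ₀ = c·e^{−A∕g₀²}`
(`FiniteEpsData.real.rho_zero`), so the natural class weights of an R-operation expansion of the run's dressed density sum to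
`∫ e^{t·obs_K} ρ₀ dU = c_K · schemeZ … K t` with the run's constant `c_K > 0` (`HistoryRealiseCellsRunApex.exists_const_schemeZ`) — the letter in which
the count road's witnesses carry E1∕E2 (`CountRoadWitness.reprA ∕ reprB`).  THIS FILE shows the K5 join does not care: N20's `RelWeightBound`, N21's
`ShellWeightBound` and N19's `Core` are invariant under positive per-cutoff rescaling of each run (`HistoryHybridRescale.hybridNE7_smul`), so class
weights satisfying E1∕E2 UP TO positive constants per cutoff — in particular Bałaban-normalised ones — give the route module's `SpineDatum` verbatim.
A typing input for the `SRec` definer (NODE 00 ₉ ∕ rev 1): the carriers of record may be stated in Bałaban's normalisation.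

WHAT IS KERNEL-CHECKED ([bookkeeping] ∕ [folklore]; 0 `def`, 0 `sorry`).
* §1 `spineDatum_of_stringHybridNE7` ∕ `stringHybridNE7_of_spineDatum` ∕ **`spineDatum_iff_stringHybridNE7`** — `YMDAG.UVSplit.SpineDatum D g₀ os ↔
  ∃ l₀ vol K₀, 0 < l₀ ∧ 0 < vol ∧ T4MatchingAssembly.StringHybridNE7 (D.scheme g₀) os l₀ vol K₀`; `spineDatum_forall_iff_stringwise` — `(∀ os, SpineDatum
  D g₀ os) ↔ T4ApexHybrid.StringwiseHybridNE7 (D.scheme g₀)` (the route module proves `→` only, `stringHybridNE7_of_spineDatum`).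
* §2 **`spineDatum_of_scaledDictionary`** — `0 < l₀`, `0 < vol`, N20, N21, N19's ∃δ-edge at class weights `A`, `B` with
  `∀ K, ∃ c > 0, ∀ |t| ≤ l₀, c · schemeZ … (K₀ + K) t = Σ_{T K} A K t` (idem `B` at `K₀ + K + 1`) ⇒ `SpineDatum D g₀ os` (budget from the tail,
  `hybridNE7_of_core_tail`; rescaling by `c⁻¹`, `hybridNE7_smul`); **`spineDatum_of_densRepr`** — the same with E1∕E2 stated as the REPRESENTATION
  IDENTITIES of the dressed density in Bałaban's normalisation (`exists_const_schemeZ` supplies the constants).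
* §3 (record level) **`spine_of_coreEdge_densRepr`** — XII's `spine_of_coreEdge` with the existence stub in REPRESENTATION letter: per record pair,
  under the pins, every string has spine carriers of record `S` with `0 < S.l₀`, `0 < S.vol` whose class sums ARE the dressed-density integrals
  `∫ e^{t·prodObs} ρ₀` at cutoffs `S.K₀ + K`, `S.K₀ + K + 1`; with `S_N20`, `S_N21`, the ∃δ-edge and K4's hook ⇒ `Spine Rec`.

HONEST FRAMING.  Bookkeeping over PARAMETERS and hypothesis shapes: no record predicate, carrier, expansion or estimate of Bałaban's is instantiated or
asserted; the representation identities are HYPOTHESES (what an R-operation expansion of record would deliver), not derived from a construction; NE7 ∕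
NE7b ∕ NE7c not proved; NO node is discharged; typed 28∕28, discharged count untouched; one finite four-torus programme — NOT ℝ⁴, NOT infinite volume,
NOT OS, NOT a mass gap, NOT Clay.  Restate-immune (neither the Theses file nor g0's module imported).  No decl below carries a cite tag.
-/

open Finset MeasureTheory

namespace Summit.QuantumFields.YangMills.Theorems.BalabanUVNodesN27SpineRecord

open Literature.MathematicalPhysics.QuantumFieldTheory.Balaban1983to89
open Literature.MathematicalPhysics.QuantumFieldTheory.Balaban1983to89.T4Continuum
open T4WeightBudget (RelWeightBound)
open T4IndicatorShell (ShellWeightBound)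
open T4MatchingAssembly (HybridNE7 StringHybridNE7)
open T4ContinuumYM4Torus (ForSmallCouplings)
open Summit.QuantumFields.BalabanUV.T4Continuum.Spine
open Summit.QuantumFields.BalabanUV.T4Continuum.HistoryHybridRescale (hybridNE7_smul)
open Summit.QuantumFields.BalabanUV.T4Continuum.HistoryRealiseCellsRunApex (exists_const_schemeZ)
open YMDAG.UVSplit

/-! ## §1 `SpineDatum` IS the apex's per-string hybrid-NE7 shape -/

section Faithful

variable {F : T4Family} {N : ℕ} [NeZero N]

/-- The apex's per-string shape gives the route module's `SpineDatum` (unfold `StringHybridNE7`, split `HybridNE7` into its five leaves by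
`weight` ∕ `shell` ∕ `NE7.core_of_hybridNE7` ∕ `lt_one` ∕ `summable`). [bookkeeping] -/
theorem spineDatum_of_stringHybridNE7 (D : Datum F N) (g₀ : ℕ → ℝ) (os : List (ULoop F)) {l₀ vol : ℝ} {K₀ : ℕ}
    (hl₀ : 0 < l₀) (hvol : 0 < vol) (h : StringHybridNE7 (D.scheme g₀) os l₀ vol K₀) : SpineDatum D g₀ os := by
  obtain ⟨ι, _, T, A, B, shA, shB, Bad, W, Wsh, δ, hH, hE1, hE2⟩ := h
  exact ⟨ι, ‹_›, l₀, vol, K₀, T, A, B, shA, shB, Bad, W, Wsh, δ, hl₀, hvol, hH.weight, hH.shell, NE7.core_of_hybridNE7 hH, hH.lt_one,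
    hH.summable, hE1, hE2⟩

/-- The route module's `SpineDatum` gives the apex's per-string shape with its radius, volume letter and offset (`Spine.NE7.hybridNE7_of_core`).
[bookkeeping] -/
theorem stringHybridNE7_of_spineDatum' (D : Datum F N) (g₀ : ℕ → ℝ) (os : List (ULoop F)) (h : SpineDatum D g₀ os) :
    ∃ (l₀ vol : ℝ) (K₀ : ℕ), 0 < l₀ ∧ 0 < vol ∧ StringHybridNE7 (D.scheme g₀) os l₀ vol K₀ := by
  obtain ⟨ι, _, l₀, vol, K₀, T, A, B, shA, shB, Bad, W, Wsh, δ, hl₀, hvol, hW, hSh, hcore, hlt, hδ, hZA, hZB⟩ := h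
  exact ⟨l₀, vol, K₀, hl₀, hvol, ι, ‹_›, T, A, B, shA, shB, Bad, W, Wsh, δ, NE7.hybridNE7_of_core hW hSh hlt hδ hcore, hZA, hZB⟩

/-- **FAITHFULNESS BELOW THE PREFIX, ONE STRING**: `SpineDatum D g₀ os ↔ ∃ l₀ vol K₀, 0 < l₀ ∧ 0 < vol ∧ StringHybridNE7 (D.scheme g₀) os l₀ vol K₀`.
[bookkeeping] -/
theorem spineDatum_iff_stringHybridNE7 (D : Datum F N) (g₀ : ℕ → ℝ) (os : List (ULoop F)) :
    SpineDatum D g₀ os ↔ ∃ (l₀ vol : ℝ) (K₀ : ℕ), 0 < l₀ ∧ 0 < vol ∧ StringHybridNE7 (D.scheme g₀) os l₀ vol K₀ :=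
  ⟨stringHybridNE7_of_spineDatum' D g₀ os, fun ⟨_, _, _, hl₀, hvol, h⟩ => spineDatum_of_stringHybridNE7 D g₀ os hl₀ hvol h⟩

/-- **FAITHFULNESS BELOW THE PREFIX, ALL STRINGS**: `(∀ os, SpineDatum D g₀ os) ↔ T4ApexHybrid.StringwiseHybridNE7 (D.scheme g₀)` — the route
module's `stringHybridNE7_of_spineDatum` is the `→` half. [bookkeeping] -/
theorem spineDatum_forall_iff_stringwise (D : Datum F N) (g₀ : ℕ → ℝ) :
    (∀ os : List (ULoop F), SpineDatum D g₀ os) ↔ T4ApexHybrid.StringwiseHybridNE7 (D.scheme g₀) :=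
  ⟨stringHybridNE7_of_spineDatum D g₀, fun h os => by
    obtain ⟨l₀, vol, K₀, hl₀, hvol, hS⟩ := h os
    exact spineDatum_of_stringHybridNE7 D g₀ os hl₀ hvol hS⟩

end Faithful

/-! ## §2 `SpineDatum` from class weights in ANY positive per-cutoff normalisation; from the representation identities in Bałaban's -/

section Normalisation

variable {F : T4Family} {N : ℕ} [NeZero N]

/-- **`SpineDatum` FROM A DICTIONARY UP TO POSITIVE CONSTANTS.**  Term-class carriers with `0 < l₀`, `0 < vol`, N20 `RelWeightBound`, N21
`ShellWeightBound`, N19's ∃δ-edge (some summable `δ` with `Spine.NE7.Core` on the shell-free cores), and class sums that are a POSITIVE MULTIPLE, cutoff by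
cutoff, of the Wilson-normalised dressed partition functions (`c_K · schemeZ … (K₀ + K) t = Σ_{T K} A K t`, `c′_K · schemeZ … (K₀ + K + 1) t = Σ_{T K} B K t`)
give `YMDAG.UVSplit.SpineDatum D g₀ os`: the budget clause from the tail (`hybridNE7_of_core_tail`), then run A rescaled by `c⁻¹`, run B by `c′⁻¹`
(`HistoryHybridRescale.hybridNE7_smul` — the weight and shell clauses are relative, `W`, `Wsh`, `δ` unchanged, the core constant moves), and the witness
carriers are the rescaled shifted families at offset `K₀ + K₁`. [bookkeeping] [folklore] -/
theorem spineDatum_of_scaledDictionary (D : Datum F N) (g₀ : ℕ → ℝ) (os : List (ULoop F))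
    {ι : Type} [DecidableEq ι] {l₀ vol : ℝ} (K₀ : ℕ) {T : ℕ → Finset ι} {A B shA shB : ℕ → ℝ → ι → ℝ}
    {Bad : ℕ → ℝ → Finset ι} {W Wsh : ℕ → ℝ}
    (hl₀ : 0 < l₀) (hvol : 0 < vol) (h20 : RelWeightBound l₀ T A B Bad W) (h21 : ShellWeightBound l₀ T A B shA shB Wsh)
    (h19 : ∃ δ : ℕ → ℝ,
      NE7.Core l₀ vol T Bad (fun K t τ => A K t τ - shA K t τ) (fun K t τ => B K t τ - shB K t τ) δ ∧ Summable δ)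
    (hE1 : ∀ K : ℕ, ∃ c : ℝ, 0 < c ∧ ∀ t : ℝ, |t| ≤ l₀ →
      c * T4GenFunBounds.schemeZ (D.scheme g₀) os (K₀ + K) t = ∑ τ ∈ T K, A K t τ)
    (hE2 : ∀ K : ℕ, ∃ c : ℝ, 0 < c ∧ ∀ t : ℝ, |t| ≤ l₀ →
      c * T4GenFunBounds.schemeZ (D.scheme g₀) os (K₀ + K + 1) t = ∑ τ ∈ T K, B K t τ) :
    SpineDatum D g₀ os := by
  choose c hc hcZ using hE1
  choose c' hc' hcZ' using hE2
  obtain ⟨δ, hcore, hδ⟩ := h19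
  obtain ⟨K₁, hH⟩ := hybridNE7_of_core_tail h20 h21 hδ hcore
  have hz : ∀ K, 0 < (c (K₁ + K))⁻¹ := fun K => inv_pos.2 (hc _)
  have hz' : ∀ K, 0 < (c' (K₁ + K))⁻¹ := fun K => inv_pos.2 (hc' _)
  have hH' := hybridNE7_smul (z := fun K => (c (K₁ + K))⁻¹) (z' := fun K => (c' (K₁ + K))⁻¹) hz hz' hH
  refine ⟨ι, ‹_›, l₀, vol, K₀ + K₁, fun K => T (K₁ + K), fun K t τ => (c (K₁ + K))⁻¹ * A (K₁ + K) t τ,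
    fun K t τ => (c' (K₁ + K))⁻¹ * B (K₁ + K) t τ, fun K t τ => (c (K₁ + K))⁻¹ * shA (K₁ + K) t τ,
    fun K t τ => (c' (K₁ + K))⁻¹ * shB (K₁ + K) t τ, fun K => Bad (K₁ + K), fun K => W (K₁ + K), fun K => Wsh (K₁ + K),
    fun K => δ (K₁ + K), hl₀, hvol, hH'.weight, hH'.shell, NE7.core_of_hybridNE7 hH', hH'.lt_one, hH'.summable,
    fun K t ht => ?_, fun K t ht => ?_⟩
  · have e : K₀ + K₁ + K = K₀ + (K₁ + K) := add_assoc _ _ _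
    have h2 := hcZ (K₁ + K) t ht
    have hcp := hc (K₁ + K)
    rw [e, ← mul_sum, ← h2, ← mul_assoc, inv_mul_cancel₀ hcp.ne', one_mul]
  · have e : K₀ + K₁ + K + 1 = K₀ + (K₁ + K) + 1 := by rw [add_assoc K₀ K₁ K]
    have h2 := hcZ' (K₁ + K) t ht
    have hcp := hc' (K₁ + K)
    rw [e, ← mul_sum, ← h2, ← mul_assoc, inv_mul_cancel₀ hcp.ne', one_mul]

/-- **`SpineDatum` FROM THE REPRESENTATION IDENTITIES IN BAŁABAN'S NORMALISATION** (the count road's `reprA` ∕ `reprB` letter, one string): class sums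
that ARE the dressed-density integrals `∫ e^{t·prodObs_K} ρ₀ dU` of the datum at cutoffs `K₀ + K` (run A) and `K₀ + K + 1` (run B), `ρ₀ = D.dens K (g₀ K) 0`,
with N20, N21, the ∃δ-edge ⇒ `SpineDatum D g₀ os` — the constants `c_K > 0` with `∫ e^{t·prodObs_K} ρ₀ = c_K · schemeZ … K t` are
`HistoryRealiseCellsRunApex.exists_const_schemeZ` (Bałaban's `ρ₀ = c·e^{−A∕g₀²}` versus the Wilson weight), absorbed by `spineDatum_of_scaledDictionary`.
[bookkeeping] [folklore] -/
theorem spineDatum_of_densRepr (D : Datum F N) (g₀ : ℕ → ℝ) (os : List (ULoop F))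
    {ι : Type} [DecidableEq ι] {l₀ vol : ℝ} (K₀ : ℕ) {T : ℕ → Finset ι} {A B shA shB : ℕ → ℝ → ι → ℝ}
    {Bad : ℕ → ℝ → Finset ι} {W Wsh : ℕ → ℝ}
    (hl₀ : 0 < l₀) (hvol : 0 < vol) (h20 : RelWeightBound l₀ T A B Bad W) (h21 : ShellWeightBound l₀ T A B shA shB Wsh)
    (h19 : ∃ δ : ℕ → ℝ,
      NE7.Core l₀ vol T Bad (fun K t τ => A K t τ - shA K t τ) (fun K t τ => B K t τ - shB K t τ) δ ∧ Summable δ)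
    (hA : ∀ (K : ℕ) (t : ℝ), |t| ≤ l₀ →
      ∫ U, Real.exp (t * T4GenFunBounds.prodObs (D.scheme g₀) (K₀ + K) os U) * D.dens (K₀ + K) (g₀ (K₀ + K)) 0 U
          ∂fieldMeasure (F.P (K₀ + K)) 0 (SU N) = ∑ τ ∈ T K, A K t τ)
    (hB : ∀ (K : ℕ) (t : ℝ), |t| ≤ l₀ →
      ∫ U, Real.exp (t * T4GenFunBounds.prodObs (D.scheme g₀) (K₀ + K + 1) os U) * D.dens (K₀ + K + 1) (g₀ (K₀ + K + 1)) 0 U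
          ∂fieldMeasure (F.P (K₀ + K + 1)) 0 (SU N) = ∑ τ ∈ T K, B K t τ) :
    SpineDatum D g₀ os := by
  refine spineDatum_of_scaledDictionary D g₀ os K₀ hl₀ hvol h20 h21 h19 (fun K => ?_) (fun K => ?_)
  · obtain ⟨c, hc, h⟩ := exists_const_schemeZ D g₀ os (K₀ + K)
    exact ⟨c, hc, fun t ht => ((h t).symm.trans (hA K t ht))⟩
  · obtain ⟨c, hc, h⟩ := exists_const_schemeZ D g₀ os (K₀ + K + 1)
    exact ⟨c, hc, fun t ht => ((h t).symm.trans (hB K t ht))⟩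

end Normalisation

/-! ## §3 Record level: B5 at the record with the existence stub in REPRESENTATION letter -/

section Record

variable {N : ℕ} [NeZero N] (Rec : RecordPred N) (SRec : SpineRecordPred N) (Inputs : InputsPred N)

/-- **N27 = B5 AT THE RECORD, THE EXPANSION OF RECORD IN BAŁABAN'S NORMALISATION.**  XII's `spine_of_coreEdge` with the existence stub `S_N27x`
replaced by its REPRESENTATION-letter twin: for every record pair, under the pins, every loop string carries spine carriers of record `S` with
`0 < S.l₀`, `0 < S.vol` whose class sums are the dressed-density integrals `∫ e^{t·prodObs} ρ₀` at cutoffs `S.K₀ + K` (run A, weights `S.A K`) and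
`S.K₀ + K + 1` (run B, weights `S.B K`); with `S_N20 SRec`, `S_N21 SRec`, the ∃δ-edge of N19 and K4's hook `SpineRates Rec Inputs` this gives `Spine Rec`
(`ForSmallCouplings.and`, per string `spineDatum_of_densRepr`, then the route module's `stringHybridNE7_of_spineDatum` string by string).
[bookkeeping] [folklore] -/
theorem spine_of_coreEdge_densRepr
    (hx : ∀ (F : T4Family) (D : Datum F N) (w : DagBinding.WorldP), Rec F D w →
      B16.EndStatementBPrinted D.C → DagBinding.EndpointExistence D.C.toB12 →
        ForSmallCouplings D fun g₀ => ∀ os : List (ULoop F), ∃ S : SpineCarriers,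
          SRec F D g₀ os S ∧ 0 < S.l₀ ∧ 0 < S.vol ∧
            (∀ (K : ℕ) (t : ℝ), |t| ≤ S.l₀ →
              ∫ U, Real.exp (t * T4GenFunBounds.prodObs (D.scheme g₀) (S.K₀ + K) os U) * D.dens (S.K₀ + K) (g₀ (S.K₀ + K)) 0 U
                  ∂fieldMeasure (F.P (S.K₀ + K)) 0 (SU N) = ∑ τ ∈ S.T K, S.A K t τ) ∧
            (∀ (K : ℕ) (t : ℝ), |t| ≤ S.l₀ →
              ∫ U, Real.exp (t * T4GenFunBounds.prodObs (D.scheme g₀) (S.K₀ + K + 1) os U) *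
                  D.dens (S.K₀ + K + 1) (g₀ (S.K₀ + K + 1)) 0 U ∂fieldMeasure (F.P (S.K₀ + K + 1)) 0 (SU N) = ∑ τ ∈ S.T K, S.B K t τ))
    (h20 : S_N20 SRec) (h21 : S_N21 SRec)
    (h19 : ∀ (F : T4Family) (D : Datum F N) (g₀ : ℕ → ℝ) (os : List (ULoop F)) (S : SpineCarriers),
      SRec F D g₀ os S → Inputs F D g₀ os → letI := S.dec
        ∃ δ : ℕ → ℝ, NE7.Core S.l₀ S.vol S.T S.Bad (fun K t τ => S.A K t τ - S.shA K t τ) (fun K t τ => S.B K t τ - S.shB K t τ) δ ∧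
          Summable δ)
    (h4 : SpineRates Rec Inputs) : Spine Rec := by
  intro F D w hR
  show D.UnderHypotheses _ fun g₀ => T4ApexHybrid.StringwiseHybridNE7 (D.scheme g₀)
  intro hB hEnd
  refine ((h4 F D w hR hB hEnd).and (hx F D w hR hB hEnd)).mono fun g₀ hg =>
    stringHybridNE7_of_spineDatum D g₀ fun os => ?_
  obtain ⟨S, hS, hl₀, hvol, hA, hB'⟩ := hg.2 os
  letI := S.dec
  exact spineDatum_of_densRepr D g₀ os S.K₀ hl₀ hvol (h20 F D g₀ os S hS) (h21 F D g₀ os S hS) (h19 F D g₀ os S hS (hg.1 os)) hA hB'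

end Record

end Summit.QuantumFields.YangMills.Theorems.BalabanUVNodesN27SpineRecord
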